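import Summits.HodgeConjecture.HodgeConjecture.Theorems.PadicSemiregularLiftHodgeFermatVarietiesFibreOfBoundaryPow
import Summits.HodgeConjecture.HodgeConjecture.Theorems.PadicSemiregularLiftHodgeFermatVarietiesFibreOfBoundaryNat
import Summits.HodgeConjecture.HodgeConjecture.Theorems.PadicSemiregularLiftHodgeFermatVarietiesPairedOfLargePrimesSharp
import Literature.AlgebraicGeometry.HodgeTheory.FermatSurfaceHodgeCharacterStructureProofs
import HarnessLib

/-!
# The level analysis at a level with one small prime to ANY power — line `cancel-by-any-claim-lattice`, crux `HodgeFermatVarieties` (stmt-HodgeConjecture-1334)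

Lead c4's programme GS² (removing `p² ∤ m` from GS), stub GS²-L2a `stub_fibre_of_top_level_pow`. Setting: a prime
`p₁ ≥ 5`, a level `m` prime to `6` whose prime factors OTHER than `p₁` are all `≥ R + 3` (ANY power of `p₁` may divide
`m`), a Hodge character `α : Fin R → ℤ/m`, and a level `M ∣ m` whose unit-part multiplicity function is not even while
those of all proper multiples of `M` are. THEOREM: `p₁ ∣ M`, `M ≠ p₁`, and for some UNIT `x₀` mod `M` all but one of the
points `x₀ + j(M/p₁)` (`j < p₁`) are unit parts of level-`M` entries of `α`. (The failing prime of the refined counting is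
`p₁`; write `M = p₁^e n`, `p₁ ∤ n`: for `e = 1` the dichotomy `stub_fibre_of_boundary_nat` gives all units of the fibre
over a unit `b` — the points `crt⁻¹(1, b) + j n`, `j ≠ j₀`; for `e ≥ 2` the prime-power dichotomy
`even_or_fibre_of_boundary_pow_nat` (`…FibreOfBoundaryPow`) gives a kernel coset `{crt⁻¹((1 + p₁^{e-1}t) y₀, b)}` =
`{crt⁻¹(y₀, b) + j p₁^{e-1} n}` of `p₁` units.) The progression form, the strip step and the induction on the length are
unchanged (`…ExistsFibreOfNotPairedPow`, `…RelReachShorter`, skeleton `reach_single_pow`).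

References: [Aoki1983] N. Aoki, Math. Ann. 266 (1983) 23–54, Thm. A′ (§7), Prop. 2.2, Prop. 6.4.
-/

-- every sibling file of the line declares into `…CancelByAnyClaimLattice.PairedNull` from a differently named module
set_option linter.dupNamespace false

noncomputable section

open Finset
open Literature.AlgebraicGeometry.HodgeTheory Literature.AlgebraicGeometry.HodgeTheory.FermatCharacter

namespace Summit.HodgeConjecture.HodgeConjecture.Theorems.CancelByAnyClaimLattice

namespace PairedNull

section TopLevelPow

variable {m : ℕ} [NeZero m] {R : ℕ} {α : Fin R → ZMod m}

/-- **The level analysis at a level with ONE small prime, any power of it** (section-variable form; see the module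
docstring): the failing prime of the refined counting is forced to be `p₁`, the top non-even level is `M = p₁^e n`
(`p₁ ∤ n`), and the prime-power dichotomy gives `p₁ - 1` consecutive points `x₀ + j(M/p₁)` of a progression through a
UNIT `x₀` among the unit parts of the level-`M` entries. [cite: Aoki1983, Thm. A′ (§7), Prop. 2.2, Prop. 6.4] -/
theorem fibre_of_top_level_pow {p₁ : ℕ} (hp₁ : p₁.Prime) (hp₁5 : 5 ≤ p₁) (hm6 : m.Coprime 6)
    (hbig : ∀ q ∈ m.primeFactors, q ≠ p₁ → R + 3 ≤ q) (h : IsHodge α)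
    {M : ℕ} (hMm : M ∣ m)
    (hne : ∃ v : ZMod M,
      #(univ.filter fun i : Fin R ↦ m / m.gcd (α i).val = M ∧ ((((α i).val / (m / M)) : ℕ) : ZMod M) = -v) ≠
      #(univ.filter fun i : Fin R ↦ m / m.gcd (α i).val = M ∧ ((((α i).val / (m / M)) : ℕ) : ZMod M) = v))
    (hIH : ∀ M' : ℕ, M' ∣ m → M ∣ M' → M' ≠ M → ∀ u : ZMod M',
      #(univ.filter fun i : Fin R ↦ m / m.gcd (α i).val = M' ∧ ((((α i).val / (m / M')) : ℕ) : ZMod M') = -u) =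
      #(univ.filter fun i : Fin R ↦ m / m.gcd (α i).val = M' ∧ ((((α i).val / (m / M')) : ℕ) : ZMod M') = u)) :
    p₁ ∣ M ∧ M ≠ p₁ ∧ ∃ x₀ : ZMod M, IsUnit x₀ ∧ ∃ j₀ : ℕ, j₀ < p₁ ∧ ∀ j : ℕ, j < p₁ → j ≠ j₀ →
      ∃ i : Fin R, m / m.gcd (α i).val = M ∧
        ((((α i).val / (m / M)) : ℕ) : ZMod M) = x₀ + (j : ZMod M) * ((M / p₁ : ℕ) : ZMod M) := by
  classical
  haveI : NeZero p₁ := ⟨hp₁.ne_zero⟩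
  have hm0 : m ≠ 0 := NeZero.ne m
  have hM0 : M ≠ 0 := fun h0 ↦ hm0 (by rw [h0] at hMm; exact zero_dvd_iff.mp hMm)
  haveI : NeZero M := ⟨hM0⟩
  -- the multiplicity function of the level-`M` unit parts
  set cnt : ZMod M → ℕ := fun u ↦
    #(univ.filter fun i : Fin R ↦ m / m.gcd (α i).val = M ∧ ((((α i).val / (m / M)) : ℕ) : ZMod M) = u) with hcnt
  set T : ZMod M → ℂ := fun u ↦ (cnt u : ℂ) with hT
  have hTnat : ∀ u, ∃ k : ℕ, T u = k := fun u ↦ ⟨cnt u, rfl⟩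
  have hnotev : ¬ ∀ u, T (-u) = T u := by
    intro hev
    obtain ⟨v, hv⟩ := hne
    apply hv
    have := hev v
    simp only [hT, Nat.cast_inj] at this
    exact this
  have hspec : ∀ i, IsUnit ((((α i).val / (m / (m / m.gcd (α i).val)) : ℕ) : ZMod (m / m.gcd (α i).val))) ∧
      ((m / (m / m.gcd (α i).val) : ℕ) : ZMod m) *
        ((ZMod.val ((((α i).val / (m / (m / m.gcd (α i).val)) : ℕ) : ZMod (m / m.gcd (α i).val))) : ℕ) : ZMod m)
          = α i :=
    fun i ↦ unitPart_spec (α i)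
  have hcastM : ∀ (L : ℕ) (_ : L = M) (y : ZMod m),
      (ZMod.cast ((((y.val / (m / L)) : ℕ) : ZMod L)) : ZMod M) = (((y.val / (m / M)) : ℕ) : ZMod M) := by
    intro L hL y; subst hL; exact ZMod.cast_id _ _
  have hcast : ∀ (L M' : ℕ) (_ : L = M') (hMM' : M ∣ M') (y : ZMod m),
      (ZMod.cast ((((y.val / (m / L)) : ℕ) : ZMod L)) : ZMod M) =
        ZMod.castHom hMM' (ZMod M) ((((y.val / (m / M')) : ℕ) : ZMod M')) := by
    intro L M' hL hMM' y; subst hL; rfl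
  have hTu : ∀ u, ¬ IsUnit u → T u = 0 := by
    intro u hu
    simp only [hT, Nat.cast_eq_zero, hcnt, Finset.card_eq_zero, Finset.filter_eq_empty_iff]
    intro i _ hi
    apply hu
    have hdvd : M ∣ m / m.gcd (α i).val := by rw [hi.1]
    rw [← hi.2, ← hcastM _ hi.1 (α i)]
    exact ((hspec i).1).map (ZMod.castHom hdvd (ZMod M))
  set I : Finset (Fin R) := univ.filter fun i : Fin R ↦ m / m.gcd (α i).val = M with hI
  have hsupp_img : (univ.filter fun u : ZMod M ↦ T u ≠ 0) =
      I.image fun i ↦ ((((α i).val / (m / M)) : ℕ) : ZMod M) := by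
    ext u
    rw [mem_filter, mem_image]
    simp only [mem_univ, true_and, hT, Nat.cast_ne_zero, hcnt]
    rw [Finset.card_ne_zero]
    constructor
    · rintro ⟨i, hi⟩
      rw [mem_filter] at hi
      exact ⟨i, by rw [hI, mem_filter]; exact ⟨mem_univ _, hi.2.1⟩, hi.2.2⟩
    · rintro ⟨i, hi, hiu⟩
      rw [hI, mem_filter] at hi
      exact ⟨i, by rw [mem_filter]; exact ⟨mem_univ _, hi.2, hiu⟩⟩
  have hsuppR : #(univ.filter fun u : ZMod M ↦ T u ≠ 0) ≤ R := by
    rw [hsupp_img]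
    exact card_image_le.trans ((card_le_univ I).trans (by rw [Fintype.card_fin]))
  -- every prime of `m` (hence of `M`) is at least `5`, and the primes other than `p₁` are `≥ R + 3`
  have hMm' : ∀ p ∈ M.primeFactors, p ∈ m.primeFactors := fun p hp ↦ Nat.mem_primeFactors.mpr
    ⟨Nat.prime_of_mem_primeFactors hp, (Nat.dvd_of_mem_primeFactors hp).trans hMm, hm0⟩
  have hMbig : ∀ p ∈ M.primeFactors, p ≠ p₁ → R + 3 ≤ p := fun p hp hne' ↦ hbig p (hMm' p hp) hne'
  have hM5 : ∀ p ∈ M.primeFactors, 5 ≤ p := by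
    intro p hp
    have hpP := Nat.prime_of_mem_primeFactors hp
    have hpm := Nat.dvd_of_mem_primeFactors (hMm' p hp)
    have h2 : p ≠ 2 := by
      rintro rfl; exact absurd (Nat.Coprime.coprime_dvd_left hpm hm6) (by norm_num)
    have h3 : p ≠ 3 := by
      rintro rfl; exact absurd (Nat.Coprime.coprime_dvd_left hpm hm6) (by norm_num)
    have h4 : p ≠ 4 := by rintro rfl; exact absurd hpP (by decide)
    have := hpP.two_le
    omega
  haveI : ∀ i, NeZero (m / m.gcd (α i).val) := fun i ↦ ⟨(level_pos (α i)).ne'⟩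
  -- Aoki's criterion at conductor `M`: `T` is orthogonal to the odd primitive characters mod `M`
  have hTodd : ∀ χ : DirichletCharacter ℂ M, χ.Odd → χ.IsPrimitive → ∑ u : ZMod M, T u * χ u = 0 := by
    intro χ hχ hprim
    have key := h.aoki_criterion hMm hχ hprim (fun i ↦ m / m.gcd (α i).val) (fun i ↦ level_dvd (α i))
      (fun i ↦ ((((α i).val / (m / (m / m.gcd (α i).val)) : ℕ) : ZMod (m / m.gcd (α i).val))))
      (fun i ↦ (hspec i).1) (fun i ↦ (hspec i).2.symm)
    have hone : (∏ p ∈ M.primeFactors, (1 - χ p)) = 1 := by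
      refine Finset.prod_eq_one fun p hp ↦ ?_
      have hnu : ¬ IsUnit ((p : ℕ) : ZMod M) := by
        rw [ZMod.isUnit_iff_coprime]
        exact fun hc ↦ (Nat.prime_of_mem_primeFactors hp).one_lt.ne'
          (Nat.Coprime.eq_one_of_dvd hc (Nat.dvd_of_mem_primeFactors hp))
      rw [χ.map_nonunit hnu, sub_zero]
    have hA : (fun L : ℕ ↦ ((m.totient : ℂ) / (L.totient : ℂ)) * ∏ p ∈ L.primeFactors, (1 - χ p)) M ≠ 0 := by
      show ((m.totient : ℂ) / (M.totient : ℂ)) * ∏ p ∈ M.primeFactors, (1 - χ p) ≠ 0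
      rw [hone, mul_one]
      exact div_ne_zero (by exact_mod_cast (Nat.totient_pos.mpr (NeZero.pos m)).ne')
        (by exact_mod_cast (Nat.totient_pos.mpr (NeZero.pos M)).ne')
    have key' := sum_level_eq_zero_of_criterion χ hχ (fun i ↦ m / m.gcd (α i).val)
      (fun i ↦ (level_pos (α i)).ne')
      (fun i ↦ ((((α i).val / (m / (m / m.gcd (α i).val)) : ℕ) : ZMod (m / m.gcd (α i).val))))
      (fun L : ℕ ↦ ((m.totient : ℂ) / (L.totient : ℂ)) * ∏ p ∈ L.primeFactors, (1 - χ p)) hA key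
      (fun i ↦ ((((α i).val / (m / M)) : ℕ) : ZMod M)) (fun i hi ↦ hcastM _ hi (α i))
      (fun L i ↦ ((((α i).val / (m / L)) : ℕ) : ZMod L)) (fun L hML i hiL ↦ hcast _ L hiL hML (α i))
      (fun L ⟨i, hiL⟩ hML hLM u ↦ hIH L (hiL ▸ level_dvd (α i)) hML hLM u)
    rw [sum_comp_eq_sum_card_mul (univ.filter fun i : Fin R ↦ m / m.gcd (α i).val = M)
      (fun i ↦ ((((α i).val / (m / M)) : ℕ) : ZMod M)) (fun u ↦ (χ u)⁻¹)] at key'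
    simp only [Finset.filter_filter] at key'
    have hconj : starRingEnd ℂ (∑ u : ZMod M, T u * χ u) = 0 := by
      rw [map_sum, ← key']
      refine Finset.sum_congr rfl fun u _ ↦ ?_
      rw [map_mul, hT, Complex.conj_natCast, char_inv_eq_conj]
    have := congrArg (starRingEnd ℂ) hconj
    rwa [starRingEnd_self_apply, map_zero] at this
  -- the refined counting leaves a prime of `M` without room, necessarily `p₁`
  have hbad : ∃ p ∈ M.primeFactors, ¬ (#(univ.filter fun u : ZMod M ↦ T u ≠ 0) + 1 < p ∨
      (p = M.minFac ∧ p * p ∣ M ∧ #(univ.filter fun u : ZMod M ↦ T u ≠ 0) < p)) := by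
    by_contra hgood
    push Not at hgood
    exact hnotev (even_of_oddNull' hM5 T hTu hTodd fun p hp ↦ by
      have := hgood p hp; tauto)
  obtain ⟨p, hpmem, hpbad⟩ := hbad
  have hp : p.Prime := Nat.prime_of_mem_primeFactors hpmem
  have hpM : p ∣ M := Nat.dvd_of_mem_primeFactors hpmem
  have hple : p ≤ #(univ.filter fun u : ZMod M ↦ T u ≠ 0) + 1 := by
    by_contra hlt; exact hpbad (Or.inl (by omega))
  have hpp : p = p₁ := by
    by_contra hne'
    have := hMbig p hpmem hne'
    omega
  subst hpp
  /- `M = p^e n`, `p ∤ n`, `e ≥ 1` -/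
  obtain ⟨e, n, hpn, hMeq⟩ := Nat.exists_eq_pow_mul_and_not_dvd hM0 p hp.ne_one
  have he : 1 ≤ e := by
    by_contra he0
    have he0' : e = 0 := by omega
    rw [he0', pow_zero, one_mul] at hMeq
    exact hpn (hMeq ▸ hpM)
  have hn0 : n ≠ 0 := fun h0 ↦ hM0 (by rw [hMeq, h0, mul_zero])
  haveI : NeZero n := ⟨hn0⟩
  have hcpn : Nat.Coprime p n := (Nat.Prime.coprime_iff_not_dvd hp).mpr hpn
  have hnM : n ∣ M := ⟨p ^ e, by rw [hMeq, mul_comm]⟩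
  have hn5 : ∀ p' ∈ n.primeFactors, 5 ≤ p' := fun p' hp' ↦ hM5 p' (Nat.mem_primeFactors.mpr
    ⟨Nat.prime_of_mem_primeFactors hp', (Nat.dvd_of_mem_primeFactors hp').trans hnM, hM0⟩)
  have hnroom : ∀ p' ∈ n.primeFactors, #(univ.filter fun u : ZMod M ↦ T u ≠ 0) + 1 < p' := by
    intro p' hp'
    have hp'n := Nat.dvd_of_mem_primeFactors hp'
    have hne0 : p' ≠ p := fun he' ↦ hpn (he' ▸ hp'n)
    have := hMbig p' (Nat.mem_primeFactors.mpr ⟨Nat.prime_of_mem_primeFactors hp', hp'n.trans hnM, hM0⟩) hne0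
    omega
  -- `M ≠ p`: a prime level is even
  have hMp : M ≠ p := by
    intro hEq
    subst hEq
    exact hnotev (even_of_oddNull_prime hp T hTu hTodd)
  refine ⟨hpM, hMp, ?_⟩
  rcases Nat.lt_or_ge e 2 with he1 | he2
  · /- `e = 1`: the level-`p n` dichotomy (all `p - 1` units of the fibre over `b`), base point `crt⁻¹(1, b)` -/
    have he1' : e = 1 := by omega
    subst he1'
    rw [pow_one] at hMeq
    subst hMeq
    have hroom : ∀ p' ∈ n.primeFactors, #(univ.filter fun u : ZMod (p * n) ↦ T u ≠ 0) + 1 < p' := hnroom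
    rcases stub_fibre_of_boundary_nat p n hp hp₁5 hpn hn5 hcpn T hTnat hTu hTodd hroom with hev | ⟨b, hbu, hfib⟩
    · exact absurd hev hnotev
    haveI : Fact p.Prime := ⟨hp⟩
    have hnp : (n : ZMod p) ≠ 0 := by
      rw [Ne, ZMod.natCast_eq_zero_iff]; exact hpn
    -- the excluded index: `1 + j₀ n ≡ 0 (mod p)`
    set c : ZMod p := -(n : ZMod p)⁻¹ with hcdef
    refine ⟨(ZMod.chineseRemainder hcpn).symm (1, b), (isUnit_crt_symm_iff hcpn 1 b).mpr ⟨isUnit_one, hbu⟩,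
      c.val, ZMod.val_lt c, fun j hj hjc ↦ ?_⟩
    have hy : (1 : ZMod p) + (j : ZMod p) * (n : ZMod p) ≠ 0 := by
      intro h0
      apply hjc
      have hj' : (j : ZMod p) = c := by
        rw [hcdef]
        have : (j : ZMod p) * (n : ZMod p) = -1 := by linear_combination h0
        calc (j : ZMod p) = (j : ZMod p) * (n : ZMod p) * (n : ZMod p)⁻¹ := by
              rw [mul_assoc, mul_inv_cancel₀ hnp, mul_one]
          _ = -(n : ZMod p)⁻¹ := by rw [this]; ring
      have := congrArg ZMod.val hj'
      rwa [ZMod.val_natCast, Nat.mod_eq_of_lt hj] at this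
    have hyu : IsUnit ((1 : ZMod p) + (j : ZMod p) * (n : ZMod p)) := isUnit_iff_ne_zero.mpr hy
    have hne0 : cnt ((ZMod.chineseRemainder hcpn).symm (((hyu.unit : (ZMod p)ˣ) : ZMod p), b)) ≠ 0 := by
      have := hfib hyu.unit
      simpa only [hT, Nat.cast_ne_zero] using this
    obtain ⟨i, hi⟩ := Finset.card_ne_zero.mp hne0
    rw [mem_filter] at hi
    refine ⟨i, hi.2.1, ?_⟩
    rw [hi.2.2, IsUnit.unit_spec]
    -- `crt⁻¹(1 + j n, b) = crt⁻¹(1, b) + j · n`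
    have hdiv : p * n / p = n := Nat.mul_div_cancel_left n hp.pos
    rw [hdiv]
    have h1 : ZMod.castHom (dvd_mul_right p n) (ZMod p) ((ZMod.chineseRemainder hcpn).symm (1, b) + (j : ZMod (p * n)) * (n : ZMod (p * n))) =
        1 + (j : ZMod p) * (n : ZMod p) := by
      rw [map_add, map_mul, map_natCast, map_natCast, (castHom_crt_symm hcpn 1 b).1]
    have h2 : ZMod.castHom (dvd_mul_left n p) (ZMod n) ((ZMod.chineseRemainder hcpn).symm (1, b) + (j : ZMod (p * n)) * (n : ZMod (p * n))) = b := by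
      rw [map_add, map_mul, map_natCast, map_natCast, (castHom_crt_symm hcpn 1 b).2, ZMod.natCast_self, mul_zero, add_zero]
    have key := crt_symm_castHom hcpn ((ZMod.chineseRemainder hcpn).symm (1, b) + (j : ZMod (p * n)) * (n : ZMod (p * n)))
    rw [h1, h2] at key
    exact key
  · /- `e ≥ 2`: the prime-power dichotomy (a kernel coset of `p` units), base point `crt⁻¹(y₀, b)`, `j₀ = 0` -/
    subst hMeq
    haveI : NeZero (p ^ e) := ⟨pow_ne_zero e hp.ne_zero⟩
    have hc : (p ^ e).Coprime n := Nat.Coprime.pow_left e hcpn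
    have hd : p ^ (e - 1) ∣ p ^ e := pow_dvd_pow p (Nat.sub_le e 1)
    rcases even_or_fibre_of_boundary_pow_nat hp hp₁5 he rfl hn5 hc hd T hTnat hTu hTodd hnroom with hev | ⟨b, hbu, y₀, hfib⟩
    · exact absurd hev hnotev
    refine ⟨(ZMod.chineseRemainder hc).symm ((y₀ : ZMod (p ^ e)), b),
      (isUnit_crt_symm_iff hc _ b).mpr ⟨Units.isUnit y₀, hbu⟩, 0, hp.pos, fun j hj _ ↦ ?_⟩
    -- the kernel unit `w = 1 + p^(e-1) · (j n y₀⁻¹)`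
    set t : ZMod (p ^ e) := ((j * n : ℕ) : ZMod (p ^ e)) * ((y₀⁻¹ : (ZMod (p ^ e))ˣ) : ZMod (p ^ e)) with htdef
    have hwu : IsUnit ((1 : ZMod (p ^ e)) + ((p ^ (e - 1) : ℕ) : ZMod (p ^ e)) * (t.val : ZMod (p ^ e))) :=
      Literature.AlgebraicGeometry.HodgeTheory.AokiCoprimeSix.isUnit_one_add hp he (Or.inl he2)
    rw [ZMod.natCast_zmod_val] at hwu
    set w : (ZMod (p ^ e))ˣ := hwu.unit with hwdef
    have hwv : (w : ZMod (p ^ e)) = 1 + ((p ^ (e - 1) : ℕ) : ZMod (p ^ e)) * t := IsUnit.unit_spec _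
    have hwker : ZMod.unitsMap hd w = 1 := by
      apply Units.ext
      rw [coe_unitsMap, hwv, map_add, map_one, map_mul, map_natCast, ZMod.natCast_self, zero_mul, add_zero, Units.val_one]
    have hne0 : cnt ((ZMod.chineseRemainder hc).symm ((w : ZMod (p ^ e)) * y₀, b)) ≠ 0 := by
      have := hfib w hwker
      simpa only [hT, Nat.cast_ne_zero] using this
    obtain ⟨i, hi⟩ := Finset.card_ne_zero.mp hne0
    rw [mem_filter] at hi
    refine ⟨i, hi.2.1, ?_⟩
    rw [hi.2.2]
    -- `crt⁻¹(w y₀, b) = crt⁻¹(y₀, b) + j · (p^(e-1) n)`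
    have hdiv : p ^ e * n / p = p ^ (e - 1) * n := by
      have : p ^ e = p * p ^ (e - 1) := by rw [← pow_succ']; congr 1; omega
      rw [this, mul_assoc, Nat.mul_div_cancel_left _ hp.pos]
    rw [hdiv]
    have hwy : (w : ZMod (p ^ e)) * y₀ = y₀ + ((p ^ (e - 1) : ℕ) : ZMod (p ^ e)) * ((j * n : ℕ) : ZMod (p ^ e)) := by
      rw [hwv, htdef, add_mul, one_mul, mul_assoc, mul_assoc, Units.inv_mul, mul_one]
    have h1 : ZMod.castHom (dvd_mul_right (p ^ e) n) (ZMod (p ^ e))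
        ((ZMod.chineseRemainder hc).symm ((y₀ : ZMod (p ^ e)), b) + (j : ZMod (p ^ e * n)) * ((p ^ (e - 1) * n : ℕ) : ZMod (p ^ e * n))) =
        (w : ZMod (p ^ e)) * y₀ := by
      rw [map_add, map_mul, map_natCast, map_natCast, (castHom_crt_symm hc _ b).1, hwy]
      push_cast; ring
    have h2 : ZMod.castHom (dvd_mul_left n (p ^ e)) (ZMod n)
        ((ZMod.chineseRemainder hc).symm ((y₀ : ZMod (p ^ e)), b) + (j : ZMod (p ^ e * n)) * ((p ^ (e - 1) * n : ℕ) : ZMod (p ^ e * n))) = b := by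
      rw [map_add, map_mul, map_natCast, map_natCast, (castHom_crt_symm hc _ b).2, Nat.cast_mul, ZMod.natCast_self,
        mul_zero, mul_zero, add_zero]
    have key := crt_symm_castHom hc ((ZMod.chineseRemainder hc).symm ((y₀ : ZMod (p ^ e)), b) +
      (j : ZMod (p ^ e * n)) * ((p ^ (e - 1) * n : ℕ) : ZMod (p ^ e * n)))
    rw [h1, h2] at key
    exact key

end TopLevelPow

/-- **GS²-L2a `stub_fibre_of_top_level_pow`** (registered form of `fibre_of_top_level_pow`). [cite: Aoki1983, Thm. A′ (§7), Prop. 2.2, Prop. 6.4] -/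
theorem stub_fibre_of_top_level_pow : ∀ (p₁ R : ℕ), p₁.Prime → 5 ≤ p₁ → ∀ {m : ℕ} [NeZero m] {α : Fin R → ZMod m}, m.Coprime 6 → (∀ q ∈ m.primeFactors, q ≠ p₁ → R + 3 ≤ q) → FermatCharacter.IsHodge α → ∀ {M : ℕ}, M ∣ m → (∃ v : ZMod M, #(univ.filter fun i : Fin R ↦ m / m.gcd (α i).val = M ∧ ((((α i).val / (m / M)) : ℕ) : ZMod M) = -v) ≠ #(univ.filter fun i : Fin R ↦ m / m.gcd (α i).val = M ∧ ((((α i).val / (m / M)) : ℕ) : ZMod M) = v)) → (∀ M' : ℕ, M' ∣ m → M ∣ M' → M' ≠ M → ∀ u : ZMod M', #(univ.filter fun i : Fin R ↦ m / m.gcd (α i).val = M' ∧ ((((α i).val / (m / M')) : ℕ) : ZMod M') = -u) = #(univ.filter fun i : Fin R ↦ m / m.gcd (α i).val = M' ∧ ((((α i).val / (m / M')) : ℕ) : ZMod M') = u)) → p₁ ∣ M ∧ M ≠ p₁ ∧ ∃ x₀ : ZMod M, IsUnit x₀ ∧ ∃ j₀ : ℕ, j₀ < p₁ ∧ ∀ j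 : ℕ, j < p₁ → j ≠ j₀ → ∃ i : Fin R, m / m.gcd (α i).val = M ∧ ((((α i).val / (m / M)) : ℕ) : ZMod M) = x₀ + (j : ZMod M) * ((M / p₁ : ℕ) : ZMod M) :=
  fun _ _ hp₁ hp₁5 _ _ _ hm6 hbig h _ hMm hne hIH ↦ fibre_of_top_level_pow hp₁ hp₁5 hm6 hbig h hMm hne hIH

end PairedNull

end Summit.HodgeConjecture.HodgeConjecture.Theorems.CancelByAnyClaimLattice

end
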